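import Mathlib
import HarnessLib
import Summits.AtomisticToContinuum.BoseEinsteinCondensation.Theorems.GapWindowLadderFreeWindowCells
import Summits.AtomisticToContinuum.BoseEinsteinCondensation.Theorems.NumberPhaseSandwichLossBookkeepingCells

/-!
# GapWindowLadder — the free-case door `GapWindowResponseFree` (stmt-AtomisticToContinuum-28031), part 3/4: PARSEVAL

decomp-a2c lens-6 g14. This part: (8) Parseval over the eight children of a parent cell — the sibling pair loss of the
sine ground mode at level `k` is `G_k(L) = F_k − F_{k−1}` EXACTLY (`Greal_eq_Fexp`); (9) the allowance table
`e(k) = (5/4)(F_k − F_{k−1}) + 2^{-k}/100 > 0` with rows `Σ_{k≤K} e(k) ≤ 3/4` (telescoping + `F_0 ≥ 0.512`);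
(10a) the Young / parallelogram bound `|z₁ − z₂|² ≤ (5/4)|α|²|a₁ − a₂|² + 10|z₁ − αa₁|² + 10|z₂ − αa₂|²` and the
pair-sum bookkeeping over children. See part 1 (`GapWindowLadderFreeWindowModes`) for the whole argument.
(`NumberPhaseSandwichLossBookkeepingCells` is imported for the dyadic parent/children combinatorics `par`, `children`,
`subCell_parent_eq`, `parseval_real`, exactly as `GapWindowLadderLossBookkeeping` already does.)
-/

noncomputable section

namespace Summit.AtomisticToContinuum.BoseEinsteinCondensation.Theorems.GapWindowLadderFreeWindowParseval

open scoped BigOperators Topology ENNReal NNReal ComplexConjugate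
open Filter MeasureTheory Set
open Literature.MathematicalPhysics.QuantumManyBody.BoseGas
open Literature.MathematicalPhysics.QuantumManyBody.NeumannBox
open Literature.MathematicalPhysics.QuantumManyBody.DirichletBox
open Summit.AtomisticToContinuum.BoseEinsteinCondensation.Theorems.NumberPhaseSandwichLossBookkeepingCells
open Summit.AtomisticToContinuum.BoseEinsteinCondensation.Theorems.GapWindowLadderFreeWindowModes
open Summit.AtomisticToContinuum.BoseEinsteinCondensation.Theorems.GapWindowLadderFreeWindowCells

/-! ## 8. Parseval over the eight children: the sibling pair loss of the sine mode is `F_k − F_{k−1}` -/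

section Parseval

/-- a parent has exactly eight children (`k ≥ 1`). -/
theorem card_children {k : ℕ} (hk : 1 ≤ k) (P : SubIdx (2 ^ (k - 1))) : (children P).card = 8 := by
  refine le_antisymm ?_ (eight_le_card_children hk P)
  have h1 : (Finset.univ.image (child hk P)).card ≤ 8 := by
    refine Finset.card_image_le.trans ?_
    simp
  refine le_trans (Finset.card_le_card fun c hc => ?_) h1
  rw [mem_children] at hc
  refine Finset.mem_image.2 ⟨fun j => ⟨(c j : ℕ) % 2, Nat.mod_lt _ two_pos⟩, Finset.mem_univ _, ?_⟩
  funext j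
  apply Fin.ext
  simp only [child]
  have := congrArg (fun f => ((f j : ℕ))) hc
  simp only [par_apply] at this
  omega

/-- `L/2^{k-1} = 2·(L/2^k)`. -/
theorem level_pred_eq {k : ℕ} (hk : 1 ≤ k) (L : ℝ) : L / 2 ^ (k - 1) = 2 * (L / 2 ^ k) := by
  obtain ⟨k', rfl⟩ := Nat.exists_eq_add_of_le' hk
  simp only [Nat.add_sub_cancel, pow_succ]
  field_simp

/-- additivity of the cell masses: `a_P = Σ_{c child of P} a_c`. -/
theorem cellMass_parent_eq {L : ℝ} (hL : 0 < L) {k : ℕ} (hk : 1 ≤ k) (P : SubIdx (2 ^ (k - 1))) :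
    cellMass L (k - 1) P = ∑ c ∈ children P, cellMass L k c := by
  have hℓ : 0 < L / 2 ^ k := by positivity
  unfold cellMass
  rw [level_pred_eq hk, subCell_parent_eq hk hℓ P, integral_biUnion_finset _ (fun c _ => measurableSet_subCell _ c)
    (pairwiseDisjoint_children hℓ P) (fun c _ => (integrable_sineMode L).integrableOn)]

/-- **Parseval over the children**: `G_k(L) = F_k(L) − F_{k−1}(L)` (`k ≥ 1`). -/
theorem Greal_eq {L : ℝ} (hL : 0 < L) {k : ℕ} (hk : 1 ≤ k) : Greal L k = Freal L k - Freal L (k - 1) := by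
  have hpar : ∀ P : SubIdx (2 ^ (k - 1)), ∑ c ∈ children P, ∑ c' ∈ children P,
      ‖cellMass L k c - cellMass L k c'‖ ^ 2 =
        2 * (8 * ∑ c ∈ children P, ‖cellMass L k c‖ ^ 2 - ‖cellMass L (k - 1) P‖ ^ 2) := by
    intro P
    have h := parseval_real (children P) (cellMass L k)
    rw [card_children hk P, ← cellMass_parent_eq hL hk P] at h
    push_cast at h
    linarith
  unfold Greal Freal
  simp_rw [hpar]
  rw [sum_eq_sum_children (fun c => ‖cellMass L k c‖ ^ 2), level_pred_eq hk L, Finset.mul_sum, Finset.mul_sum,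
    Finset.mul_sum, Finset.mul_sum, ← Finset.sum_sub_distrib]
  refine Finset.sum_congr rfl fun P _ => ?_
  have hℓ : (L / 2 ^ k) ≠ 0 := by positivity
  field_simp
  ring

/-- `0 ≤ G_k(L)`. -/
theorem Greal_nonneg {L : ℝ} (hL : 0 < L) (k : ℕ) : 0 ≤ Greal L k := by
  unfold Greal
  refine mul_nonneg (by norm_num) (mul_nonneg (by positivity) ?_)
  exact Finset.sum_nonneg fun P _ => Finset.sum_nonneg fun c _ => Finset.sum_nonneg fun c' _ => sq_nonneg _

/-- `G_k(L) = F_k − F_{k−1}` explicitly (`k ≥ 1`, any `L > 0`). -/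
theorem Greal_eq_Fexp {L : ℝ} (hL : 0 < L) {k : ℕ} (hk : 1 ≤ k) : Greal L k = Fexp k - Fexp (k - 1) := by
  rw [Greal_eq hL hk, Freal_eq hL, Freal_eq hL]

/-- `0 ≤ F_k − F_{k−1}` (the coarse-grained sine mass increases under refinement). -/
theorem Fexp_sub_nonneg (k : ℕ) : 0 ≤ Fexp k - Fexp (k - 1) := by
  rcases Nat.eq_zero_or_pos k with rfl | hk
  · simp
  · rw [← Greal_eq_Fexp one_pos hk]; exact Greal_nonneg one_pos k

end Parseval

/-! ## 9. The allowance table -/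

section Table

/-- every entry of the allowance table is positive. -/
theorem eTab_pos (k : ℕ) : 0 < eTab k := by
  unfold eTab
  have := Fexp_sub_nonneg k
  positivity

/-- telescoping: `Σ_{k≤K} (F_k − F_{k−1}) = F_K − F_0` (with `F_{−1} := F_0`). -/
theorem sum_telescope (F : ℕ → ℝ) (K : ℕ) : ∑ k ∈ Finset.range (K + 1), (F k - F (k - 1)) = F K - F 0 := by
  induction K with
  | zero => simp
  | succ K ih => rw [Finset.sum_range_succ, ih, Nat.add_sub_cancel]; ring

/-- `Σ_{k≤K} 2^{-k}/100 ≤ 2/100`. -/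
theorem sum_half_pow_le (K : ℕ) : ∑ k ∈ Finset.range (K + 1), (1 / 2 : ℝ) ^ k ≤ 2 := by
  rw [geom_sum_eq (by norm_num) (K + 1)]
  have : (0 : ℝ) < (1 / 2) ^ (K + 1) := by positivity
  have h2 : ((1 / 2 : ℝ) ^ (K + 1) - 1) / (1 / 2 - 1) = 2 * (1 - (1 / 2) ^ (K + 1)) := by ring
  rw [h2]; linarith

/-- `(8/π²)³ ≥ 0.512`. -/
theorem Fexp_zero_ge : (0.512 : ℝ) ≤ Fexp 0 := by
  rw [Fexp_zero]
  have hπ := Real.pi_lt_d2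
  have hπ0 := Real.pi_pos
  have h1 : (0.8 : ℝ) ≤ 8 / Real.pi ^ 2 := by
    rw [le_div_iff₀ (by positivity)]; nlinarith
  nlinarith [pow_le_pow_left₀ (by norm_num) h1 3]

/-- **The rows of the table are at most `3/4`.** -/
theorem sum_eTab_le (K : ℕ) : ∑ k ∈ Finset.range (K + 1), eTab k ≤ 3 / 4 := by
  unfold eTab
  rw [Finset.sum_add_distrib, ← Finset.mul_sum, ← Finset.sum_div, sum_telescope]
  have h1 := Fexp_le_one K
  have h2 := Fexp_zero_ge
  have h3 := sum_half_pow_le K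
  nlinarith

end Table

/-! ## 10. The free gap-window law -/

section Law

variable {n : ℕ} {L : ℝ}

/-- Young (`η = 1/4`) and the parallelogram bound:
`|z₁ − z₂|² ≤ (5/4)|α|²|a₁ − a₂|² + 10|z₁ − αa₁|² + 10|z₂ − αa₂|²`. -/
theorem norm_sub_sq_le_young (z₁ z₂ α a₁ a₂ : ℂ) :
    ‖z₁ - z₂‖ ^ 2 ≤
      5 / 4 * (‖α‖ ^ 2 * ‖a₁ - a₂‖ ^ 2) + 10 * ‖z₁ - α * a₁‖ ^ 2 + 10 * ‖z₂ - α * a₂‖ ^ 2 := by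
  have h1 : z₁ - z₂ = α * (a₁ - a₂) + ((z₁ - α * a₁) - (z₂ - α * a₂)) := by ring
  have h2 : ‖z₁ - z₂‖ ≤ ‖α‖ * ‖a₁ - a₂‖ + ‖z₁ - α * a₁‖ + ‖z₂ - α * a₂‖ := by
    rw [h1]
    calc ‖α * (a₁ - a₂) + ((z₁ - α * a₁) - (z₂ - α * a₂))‖
        ≤ ‖α * (a₁ - a₂)‖ + ‖(z₁ - α * a₁) - (z₂ - α * a₂)‖ := norm_add_le _ _
      _ ≤ ‖α‖ * ‖a₁ - a₂‖ + (‖z₁ - α * a₁‖ + ‖z₂ - α * a₂‖) := by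
          rw [norm_mul]; exact add_le_add le_rfl (norm_sub_le _ _)
      _ = _ := by ring
  have hx : 0 ≤ ‖α‖ * ‖a₁ - a₂‖ := by positivity
  have hy : 0 ≤ ‖z₁ - α * a₁‖ := norm_nonneg _
  have hw : 0 ≤ ‖z₂ - α * a₂‖ := norm_nonneg _
  have h0 : 0 ≤ ‖z₁ - z₂‖ := norm_nonneg _
  have h3 : ‖z₁ - z₂‖ ^ 2 ≤ (‖α‖ * ‖a₁ - a₂‖ + ‖z₁ - α * a₁‖ + ‖z₂ - α * a₂‖) ^ 2 := by gcongr
  nlinarith [sq_nonneg (‖α‖ * ‖a₁ - a₂‖ - 8 * ‖z₁ - α * a₁‖),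
    sq_nonneg (‖α‖ * ‖a₁ - a₂‖ - 8 * ‖z₂ - α * a₂‖), sq_nonneg (‖z₁ - α * a₁‖ - ‖z₂ - α * a₂‖)]

/-- the same in `ℝ≥0∞`. -/
theorem enorm_sub_sq_le_young (z₁ z₂ α a₁ a₂ : ℂ) :
    ‖z₁ - z₂‖ₑ ^ 2 ≤
      ENNReal.ofReal (5 / 4) * (‖α‖ₑ ^ 2 * ‖a₁ - a₂‖ₑ ^ 2) + 10 * ‖z₁ - α * a₁‖ₑ ^ 2 +
        10 * ‖z₂ - α * a₂‖ₑ ^ 2 := by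
  have e : ∀ z : ℂ, ‖z‖ₑ ^ 2 = ENNReal.ofReal (‖z‖ ^ 2) := fun z => by
    rw [← ofReal_norm, ENNReal.ofReal_pow (norm_nonneg _)]
  calc ‖z₁ - z₂‖ₑ ^ 2 = ENNReal.ofReal (‖z₁ - z₂‖ ^ 2) := e _
    _ ≤ ENNReal.ofReal (5 / 4 * (‖α‖ ^ 2 * ‖a₁ - a₂‖ ^ 2) + 10 * ‖z₁ - α * a₁‖ ^ 2 +
          10 * ‖z₂ - α * a₂‖ ^ 2) := ENNReal.ofReal_le_ofReal (norm_sub_sq_le_young z₁ z₂ α a₁ a₂)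
    _ = _ := by
        rw [ENNReal.ofReal_add (by positivity) (by positivity), ENNReal.ofReal_add (by positivity) (by positivity),
          ENNReal.ofReal_mul (by positivity), ENNReal.ofReal_mul (by positivity),
          ENNReal.ofReal_mul (by positivity), ENNReal.ofReal_mul (by positivity)]
        simp only [← e, ENNReal.ofReal_ofNat]

/-- the sibling pair sum of the cell masses: `Σ_P Σ_{c,c'} ℓ⁻³|a_c − a_{c'}|² = 16·G_k(L)` in `ℝ≥0∞`. -/
theorem sum_cellMass_pair_eq (hL : 0 < L) (k : ℕ) :
    ∑ P : SubIdx (2 ^ (k - 1)), ∑ c ∈ children P, ∑ c' ∈ children P,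
        (ENNReal.ofReal (L / 2 ^ k) ^ 3)⁻¹ * ‖cellMass L k c - cellMass L k c'‖ₑ ^ 2 =
      16 * ENNReal.ofReal (Greal L k) := by
  have hℓ : 0 < L / 2 ^ k := by positivity
  have h16 : (16 : ℝ≥0∞) * ENNReal.ofReal 16⁻¹ = 1 := by
    rw [ENNReal.ofReal_inv_of_pos (by norm_num), ENNReal.ofReal_ofNat]
    exact ENNReal.mul_inv_cancel (by norm_num) (by norm_num)
  unfold Greal
  rw [ENNReal.ofReal_mul (by norm_num), ← mul_assoc, h16, one_mul, ENNReal.ofReal_mul (by positivity),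
    ENNReal.ofReal_inv_of_pos (by positivity), ENNReal.ofReal_pow hℓ.le,
    ENNReal.ofReal_sum_of_nonneg (fun P _ => Finset.sum_nonneg fun c _ => Finset.sum_nonneg fun c' _ => sq_nonneg _),
    Finset.mul_sum]
  refine Finset.sum_congr rfl fun P _ => ?_
  rw [ENNReal.ofReal_sum_of_nonneg (fun c _ => Finset.sum_nonneg fun c' _ => sq_nonneg _), Finset.mul_sum]
  refine Finset.sum_congr rfl fun c _ => ?_
  rw [ENNReal.ofReal_sum_of_nonneg (fun c' _ => sq_nonneg _), Finset.mul_sum]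
  refine Finset.sum_congr rfl fun c' _ => ?_
  rw [← ofReal_norm, ENNReal.ofReal_pow (norm_nonneg _)]

/-- `Σ_{c∈ch P} Σ_{c'∈ch P} g c = 8 Σ_{c∈ch P} g c` and the same for `g c'`. -/
theorem sum_children_pair_left {k : ℕ} (hk : 1 ≤ k) (P : SubIdx (2 ^ (k - 1))) (g : SubIdx (2 ^ k) → ℝ≥0∞) :
    ∑ c ∈ children P, ∑ _c' ∈ children P, g c = 8 * ∑ c ∈ children P, g c := by
  rw [Finset.mul_sum]
  refine Finset.sum_congr rfl fun c _ => ?_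
  rw [Finset.sum_const, card_children hk P, nsmul_eq_mul]
  norm_num

/-- `Σ_{c∈ch P} Σ_{c'∈ch P} g c' = 8 Σ_{c'∈ch P} g c'`. -/
theorem sum_children_pair_right {k : ℕ} (hk : 1 ≤ k) (P : SubIdx (2 ^ (k - 1))) (g : SubIdx (2 ^ k) → ℝ≥0∞) :
    ∑ _c ∈ children P, ∑ c' ∈ children P, g c' = 8 * ∑ c' ∈ children P, g c' := by
  rw [Finset.sum_const, card_children hk P, nsmul_eq_mul]
  norm_num

/-- the slice coefficient `Y ↦ ⟨s, Φ(·,Y)⟩` is strongly measurable. -/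
theorem stronglyMeasurable_coef (L : ℝ) (Φ : TrialState (n + 1) L) :
    StronglyMeasurable fun Y : Config n => ∫ x, conj (sineMode L x) * Φ.ψ (Matrix.vecCons x Y) := by
  have h : StronglyMeasurable (Function.uncurry fun (Y : Config n) (x : Space) =>
      conj (sineMode L x) * Φ.ψ (Matrix.vecCons x Y)) := by
    refine StronglyMeasurable.mul ?_ ?_
    · exact (Complex.continuous_conj.measurable.comp
        ((measurable_sineMode L).comp measurable_snd)).stronglyMeasurable
    · exact (Φ.contDiff.continuous.comp (continuous_snd.matrixVecCons continuous_fst)).stronglyMeasurable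
  exact h.integral_prod_right'

/-- slices of a trial state vanish off the box. -/
theorem slice_eq_zero (Φ : TrialState (n + 1) L) (Y : Config n) :
    ∀ x, x ∉ box L → Φ.ψ (Matrix.vecCons x Y) = 0 :=
  fun x hx => Φ.eq_zero _ fun hX => hx (by simpa using hX 0)

/-- `∫ dY ∫ dx |Φ(x,Y)|² = 1`. -/
theorem lintegral_lintegral_slice_sq (Φ : TrialState (n + 1) L) :
    ∫⁻ Y : Config n, ∫⁻ x, ‖Φ.ψ (Matrix.vecCons x Y)‖ₑ ^ 2 = 1 := by
  have hF : Measurable fun X : Config (n + 1) => ‖Φ.ψ X‖ₑ ^ 2 :=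
    Φ.contDiff.continuous.measurable.enorm.pow_const _
  have hsw : AEMeasurable (Function.uncurry fun (Y : Config n) (x : Space) =>
      ‖Φ.ψ (Matrix.vecCons x Y)‖ₑ ^ 2) (volume.prod volume) :=
    ((hF.comp measurable_vecCons).comp measurable_swap).aemeasurable
  rw [lintegral_lintegral_swap hsw, lintegral_lintegral_vecCons hF]
  have := Φ.norm_eq
  simpa only [enorm_eq_nnnorm] using this

end Law

end Summit.AtomisticToContinuum.BoseEinsteinCondensation.Theorems.GapWindowLadderFreeWindowParseval
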